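import Literature.AlgebraicGeometry.Resolution.LinearSectionsBertini
import Literature.Topology.KrullDimensionDrop
import Mathlib.Data.Fin.Tuple.Take
import HarnessLib

/-!
# Choosing general hyperplanes one after the other

Topic: `Literature/AlgebraicGeometry/Resolution`. The bookkeeping of "choose `t₀, …, t_{n-1}`
general, each general with respect to the previous ones" (de Jong 1996, 2.11: "we choose […] and
we let `π` be the composition of projection morphisms as in 2.11, adapted to `Z` and `X`";
Hartshorne II 8.18, and I Prop. 7.1 / Ex. 1.10 for the dimension count), for a closed subscheme
`ι : X ↪ ℙ^N_k` in the vocabulary of `LinearSectionsCharts` / `LinearSectionsBertini`: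

* `exists_seq_of_isGeneric` — given, for every step `j` and every choice of the first `j` forms
  (Mathlib `Fin.take`), a GENERIC condition on the next form, there is a sequence satisfying all of
  them (`k` infinite);
* `LinSec.genPts S` — the generic points of the irreducible components of a closed subset `S`
  (finitely many in a Noetherian space), and `isGeneric_avoid_genPts`;
* `LinSec.topologicalKrullDim_cutOf_lt` — **dimension drop**: if `t_j` avoids the generic
  points of the components of `S ∩ V(t₀,…,t_{j-1})` for every `j`, then
  `dim (S ∩ V(t₀,…,t_{j-1})) ≤ dim S - j`, and the intersection is empty once `j > dim S`;
* `LinSec.isRegularLocalRing_cut_of_steps` — **Bertini, iterated**: if each `t_j` satisfies the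
  conclusion of `isGeneric_regular_cut` for `(t₀,…,t_{j-1})`, then at every closed point `x` of
  `V(t₀,…,t_{j-1})` at which `X` is regular, `𝒪_{X,x}/(t₀,…,t_{j-1})` is regular.

Everything is proved; no named facts.

## References

* A. J. de Jong, *Smoothness, semi-stability and alterations*, Publ. Math. IHÉS 83 (1996), 2.11,
  proof of 4.11 (p. 68). [DeJong1996]
* R. Hartshorne, *Algebraic Geometry* (1977), I Prop. 7.1 and Ex. 1.10, II Thm. 8.18. [Hartshorne1977]
-/

noncomputable section

open CategoryTheory AlgebraicGeometry TopologicalSpace Opposite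
open Literature.AlgebraicGeometry.Morphisms.ProjCech (grading PP)
open Literature.AlgebraicGeometry.Motives
open Literature.Topology

attribute [local instance] MvPolynomial.gradedAlgebra

namespace Literature.AlgebraicGeometry.Resolution

universe u

/-! ## Sequences of generic choices -/

section Seq

variable {k : Type u} [Field k] [Infinite k] {V : Type*}

/-- Taking the first `j` terms of `Fin.snoc t b` (with `j` at most the old length) gives the first
`j` terms of `t` (Mathlib's `Fin.take`; no `take_snoc` in Mathlib). [folklore] -/
theorem take_snoc_of_le {n : ℕ} (t : Fin n → V) (b : V) (j : ℕ) (hj : j ≤ n) :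
    Fin.take j (hj.trans n.le_succ) (Fin.snoc t b : Fin (n + 1) → V) = Fin.take j hj t := by
  funext i
  simp only [Fin.take_apply]
  have : Fin.castLE (hj.trans n.le_succ) i = (Fin.castLE hj i).castSucc := Fin.ext rfl
  rw [this, Fin.snoc_castSucc]

variable {τ : Type*}

/-- **A sequence of generic choices exists** (over an infinite field): if for every `j` and every
choice `a` of the first `j` parameter vectors the condition `P j a` on the next one is generic,
there is `t : Fin n → (τ → k)` with `P j (t₀,…,t_{j-1}) t_j` for all `j < n`. [folklore] -/
theorem exists_seq_of_isGeneric (P : ∀ j : ℕ, (Fin j → τ → k) → (τ → k) → Prop)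
    (hP : ∀ j a, IsGeneric (P j a)) (n : ℕ) :
    ∃ t : Fin n → τ → k, ∀ (j : ℕ) (hj : j < n), P j (Fin.take j hj.le t) (t ⟨j, hj⟩) := by
  induction n with
  | zero => exact ⟨Fin.elim0, fun j hj => absurd hj (Nat.not_lt_zero j)⟩
  | succ n ih =>
    obtain ⟨t, ht⟩ := ih
    obtain ⟨b, hb⟩ := (hP n t).nonempty
    refine ⟨Fin.snoc t b, fun j hj => ?_⟩
    rcases Nat.lt_succ_iff_lt_or_eq.mp hj with hj' | rfl
    · have e1 : Fin.take j hj.le (Fin.snoc t b : Fin (n + 1) → τ → k) = Fin.take j hj'.le t :=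
        take_snoc_of_le t b j hj'.le
      have e2 : (Fin.snoc t b : Fin (n + 1) → τ → k) ⟨j, hj⟩ = t ⟨j, hj'⟩ := by
        have : (⟨j, hj⟩ : Fin (n + 1)) = (⟨j, hj'⟩ : Fin n).castSucc := Fin.ext rfl
        rw [this, Fin.snoc_castSucc]
      rw [e1, e2]; exact ht j hj'
    · have e1 : Fin.take j hj.le (Fin.snoc t b : Fin (j + 1) → τ → k) = t := by
        rw [show Fin.take j hj.le (Fin.snoc t b : Fin (j + 1) → τ → k) =
          Fin.take j le_rfl t from take_snoc_of_le t b j le_rfl, Fin.take_eq_self]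
      have e2 : (Fin.snoc t b : Fin (j + 1) → τ → k) ⟨j, hj⟩ = b := by
        have : (⟨j, hj⟩ : Fin (j + 1)) = Fin.last j := Fin.ext rfl
        rw [this, Fin.snoc_last]
      rw [e1, e2]; exact hb

end Seq

namespace LinSec

variable {k : Type u} [Field k] {N : ℕ} {X : Scheme.{u}} (ι : X ⟶ PP k N)

/-! ## Generic points of the components of a closed subset -/

/-- **The generic points of the irreducible components of a subset `S ⊆ X`** (as points of
`X`). [folklore] -/
def genPts (S : Set X) : Set X := Subtype.val '' genericPoints S

omit ι in
/-- In a Noetherian space a subset has finitely many component generic points. [folklore] -/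
theorem genPts_finite [NoetherianSpace X] (S : Set X) : (genPts S).Finite := by
  haveI : NoetherianSpace S := inferInstance
  exact (genericPoints.finite (NoetherianSpace.finite_irreducibleComponents (α := S))).image _

omit ι in
/-- The component generic points lie in `S`. [folklore] -/
theorem genPts_subset (S : Set X) : genPts S ⊆ S := by
  rintro _ ⟨η, -, rfl⟩; exact η.2

omit ι in
/-- **Every point of a closed `S` is a specialisation of a component generic point.** [folklore] -/
theorem exists_genPts_specializes [QuasiSober X] {S : Set X} (hS : IsClosed S) {x : X} (hx : x ∈ S) :
    ∃ w ∈ genPts S, w ⤳ x := by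
  haveI : QuasiSober S := quasiSober_of_isClosed hS
  let C : irreducibleComponents S := ⟨irreducibleComponent (⟨x, hx⟩ : S),
    irreducibleComponent_mem_irreducibleComponents _⟩
  let η := genericPoints.ofComponent C
  refine ⟨η.1.1, ⟨η.1, η.2, rfl⟩, ?_⟩
  have hsp : η.1 ⤳ (⟨x, hx⟩ : S) :=
    (genericPoints.isGenericPoint_ofComponent C).specializes mem_irreducibleComponent
  exact hsp.map continuous_subtype_val

/-- A generic hyperplane avoids the component generic points of `S`. [folklore] -/
theorem isGeneric_avoid_genPts [IsAffineHom ι] [NoetherianSpace X] (S : Set X) :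
    IsGeneric fun b : Fin (N + 1) → k => ∀ w ∈ genPts S, w ∉ hyp ι b :=
  isGeneric_forall_notMem_hyp ι (genPts_finite S)

/-! ## Dimension drop along a sequence of hyperplanes -/

/-- One step: if `b` misses the component generic points of the closed `S`, then
`dim (S ∩ V(b)) < m` whenever `dim S < m + 1`. [cite: Hartshorne1977, I Prop. 7.1 and Ex. 1.10] -/
theorem topologicalKrullDim_inter_hyp_lt [QuasiSober X] [T0Space X] {S : Set X} (hS : IsClosed S)
    {b : Fin (N + 1) → k} (hb : ∀ w ∈ genPts S, w ∉ hyp ι b) (m : ℕ)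
    (hdim : topologicalKrullDim S < (m + 1 : ℕ)) : topologicalKrullDim ↥(S ∩ hyp ι b) < (m : ℕ) := by
  refine topologicalKrullDim_lt_of_forall_exists_specializes hS (hS.inter (isClosed_hyp ι b))
    Set.inter_subset_left (fun z hz => ?_) m hdim
  obtain ⟨w, hw, hwz⟩ := exists_genPts_specializes hS hz.1
  exact ⟨w, genPts_subset S hw, fun h => hb w hw h.2, hwz⟩

/-- The cut of `S` by the first `j` forms of `t`. [folklore] -/
def cutOf (S : Set X) {n : ℕ} (t : Fin n → Fin (N + 1) → k) (j : ℕ) (hj : j ≤ n) : Set X :=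
  S ∩ cutSet ι (Fin.take j hj t)

/-- `V(∅) = X`. [folklore] -/
theorem cutSet_zero (a : Fin 0 → Fin (N + 1) → k) : cutSet ι a = Set.univ := by
  simp [cutSet, Set.iInter_of_empty]

/-- Cutting by one more form. [folklore] -/
theorem cutSet_take_succ {n : ℕ} (t : Fin n → Fin (N + 1) → k) (j : ℕ) (hj : j < n) :
    cutSet ι (Fin.take (j + 1) hj t) = cutSet ι (Fin.take j hj.le t) ∩ hyp ι (t ⟨j, hj⟩) := by
  rw [Fin.take_succ_eq_snoc j hj t]
  ext x
  simp only [cutSet, Set.mem_iInter, Set.mem_inter_iff]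
  constructor
  · intro h
    exact ⟨fun i => by simpa [Fin.snoc_castSucc] using h i.castSucc,
      by simpa [Fin.snoc_last] using h (Fin.last j)⟩
  · rintro ⟨h1, h2⟩ i
    refine Fin.lastCases ?_ (fun i => ?_) i
    · simpa [Fin.snoc_last] using h2
    · simpa [Fin.snoc_castSucc] using h1 i

/-- `cutOf` at `0` is `S`; at `j + 1` it is `cutOf j ∩ V(t_j)`. [folklore] -/
theorem cutOf_succ (S : Set X) {n : ℕ} (t : Fin n → Fin (N + 1) → k) (j : ℕ) (hj : j < n) :
    cutOf ι S t (j + 1) hj = cutOf ι S t j hj.le ∩ hyp ι (t ⟨j, hj⟩) := by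
  rw [cutOf, cutOf, cutSet_take_succ, Set.inter_assoc]

/-- `cutOf` is closed for `S` closed. [folklore] -/
theorem isClosed_cutOf {S : Set X} (hS : IsClosed S) {n : ℕ} (t : Fin n → Fin (N + 1) → k) (j : ℕ)
    (hj : j ≤ n) : IsClosed (cutOf ι S t j hj) :=
  hS.inter (isClosed_cutSet ι _)

/-- **Dimension drop along the sequence.** Let `S ⊆ X` be closed with `dim S < m + 1`, and
suppose that for every `j < n` the form `t_j` misses the component generic points of
`S ∩ V(t₀,…,t_{j-1})`. Then `dim (S ∩ V(t₀,…,t_{j-1})) < m + 1 - j` for all `j ≤ min n (m+1)`.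
[cite: Hartshorne1977, I Prop. 7.1 and Ex. 1.10] -/
theorem topologicalKrullDim_cutOf_lt [QuasiSober X] [T0Space X] {S : Set X} (hS : IsClosed S)
    {n : ℕ} (t : Fin n → Fin (N + 1) → k)
    (ht : ∀ (j : ℕ) (hj : j < n), ∀ w ∈ genPts (cutOf ι S t j hj.le), w ∉ hyp ι (t ⟨j, hj⟩))
    (m : ℕ) (hdim : topologicalKrullDim S < (m + 1 : ℕ)) :
    ∀ (j : ℕ) (hj : j ≤ n), j ≤ m + 1 →
      topologicalKrullDim ↥(cutOf ι S t j hj) < ((m + 1 - j : ℕ) : WithBot ℕ∞) := by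
  intro j
  induction j with
  | zero =>
    intro hj _
    have e : cutOf ι S t 0 hj = S := by rw [cutOf, cutSet_zero, Set.inter_univ]
    rw [e]; simpa using hdim
  | succ j ih =>
    intro hj hjm
    have hj' : j < n := hj
    have key := topologicalKrullDim_inter_hyp_lt ι (isClosed_cutOf ι hS t j hj'.le) (ht j hj')
      (m - j) (by
        have := ih hj'.le (by omega)
        have e : m + 1 - j = m - j + 1 := by omega
        rwa [e] at this)
    rw [cutOf_succ]
    have e : m + 1 - (j + 1) = m - j := by omega
    rwa [e]

/-- **Emptiness past the dimension**: under the hypotheses of `topologicalKrullDim_cutOf_lt`,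
`S ∩ V(t₀,…,t_m) = ∅` (i.e. after `m + 1` cuts, if `n ≥ m + 1`). [cite: Hartshorne1977, I Prop. 7.1 and Ex. 1.10] -/
theorem cutOf_eq_empty [QuasiSober X] [T0Space X] {S : Set X} (hS : IsClosed S)
    {n : ℕ} (t : Fin n → Fin (N + 1) → k)
    (ht : ∀ (j : ℕ) (hj : j < n), ∀ w ∈ genPts (cutOf ι S t j hj.le), w ∉ hyp ι (t ⟨j, hj⟩))
    (m : ℕ) (hdim : topologicalKrullDim S < (m + 1 : ℕ)) (hn : m + 1 ≤ n) :
    cutOf ι S t (m + 1) hn = ∅ := by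
  have := topologicalKrullDim_cutOf_lt ι hS t ht m hdim (m + 1) hn le_rfl
  simp only [Nat.sub_self] at this
  exact eq_empty_of_topologicalKrullDim_lt_zero (isClosed_cutOf ι hS t _ hn) this

/-! ## Bertini along the sequence -/

/-- The singular set: points with non-regular local ring. [folklore] -/
def singSet (X : Scheme.{u}) : Set X := {x | ¬IsRegularLocalRing (X.presheaf.stalk x)}

/-- The cut ideal of no forms is trivial, so `𝒪_{X,x}/()` is regular iff `𝒪_{X,x}` is.
[folklore] -/
theorem isRegularLocalRing_quotient_cutIdeal_zero_iff (x : X) (a : Fin 0 → Fin (N + 1) → k) :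
    IsRegularLocalRing (X.presheaf.stalk x ⧸ cutIdeal ι x a) ↔
      IsRegularLocalRing (X.presheaf.stalk x) := by
  rw [cutIdeal_zero]
  have e := (RingEquiv.quotientBot (X.presheaf.stalk x))
  exact ⟨fun H => @IsRegularLocalRing.of_ringEquiv _ _ H _ _ e,
    fun H => @IsRegularLocalRing.of_ringEquiv _ _ H _ _ e.symm⟩

/-- The step condition of the iterated Bertini theorem (the conclusion of
`isGeneric_regular_cut` for `(a, b)`). [folklore] -/
def BertiniStep {j : ℕ} (a : Fin j → Fin (N + 1) → k) (b : Fin (N + 1) → k) : Prop :=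
  ∀ x : X, IsClosed ({x} : Set X) → x ∈ cutSet ι a → x ∈ hyp ι b →
    IsRegularLocalRing (X.presheaf.stalk x ⧸ cutIdeal ι x a) →
      IsRegularLocalRing (X.presheaf.stalk x ⧸
        cutIdeal ι x (Fin.snoc a b : Fin (j + 1) → Fin (N + 1) → k))

/-- `BertiniStep` is generic in `b`. [cite: Hartshorne1977, II Thm. 8.18 and Rem. 8.18.1] -/
theorem isGeneric_bertiniStep [IsAlgClosed k] [IsClosedImmersion ι] {j : ℕ}
    (a : Fin j → Fin (N + 1) → k) : IsGeneric fun b => BertiniStep ι a b :=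
  isGeneric_regular_cut ι a

/-- **Bertini along the sequence**: if `t_j` satisfies `BertiniStep` for `(t₀,…,t_{j-1})` for all
`j < n`, then for every `j ≤ n` and every closed point `x ∈ V(t₀,…,t_{j-1})` at which `X` is
regular, `𝒪_{X,x}/(t₀,…,t_{j-1})` is a regular local ring.
[cite: Hartshorne1977, II Thm. 8.18 and Rem. 8.18.1] -/
theorem isRegularLocalRing_cut_of_steps {n : ℕ} (t : Fin n → Fin (N + 1) → k)
    (ht : ∀ (j : ℕ) (hj : j < n), BertiniStep ι (Fin.take j hj.le t) (t ⟨j, hj⟩)) :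
    ∀ (j : ℕ) (hj : j ≤ n) (x : X), IsClosed ({x} : Set X) → x ∈ cutSet ι (Fin.take j hj t) →
      x ∉ singSet X → IsRegularLocalRing (X.presheaf.stalk x ⧸ cutIdeal ι x (Fin.take j hj t)) := by
  intro j
  induction j with
  | zero =>
    intro hj x _ _ hxs
    rw [isRegularLocalRing_quotient_cutIdeal_zero_iff]
    exact not_not.mp hxs
  | succ j ih =>
    intro hj x hxc hx hxs
    have hj' : j < n := hj
    rw [cutSet_take_succ ι t j hj'] at hx
    have := ht j hj' x hxc hx.1 hx.2 (ih hj'.le x hxc hx.1 hxs)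
    rwa [← Fin.take_succ_eq_snoc j hj' t] at this

end LinSec

end Literature.AlgebraicGeometry.Resolution

end
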